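import Mathlib
import Summits.ResolutionOfSingularities.ResolutionOfSingularities.Theorems.EquisingularLiftEquisingularLiftNatTowerRoundFourDefs

/-!
# IncidenceEDL — res-L1-w45b-idea-2 (IDEATOR 2, gen 13), CRUX-IDEATE round 2 on stmt-ResolutionOfSingularities-20148
# (EL♮(3) = `Theses.EquisingularLift.EquisingularLiftNatThree`; objects of record: the B-residue stubs of CHILD v33
# `stub_elnat_three_isolated_nonDefTowerB` f16b5ad73ab42d74 / `stub_elnat_three_nonisolated_nonDefNoseTowerB` c3c59d94ef62121b).

[OURS · L1 W4.5(b)] TYPED DELIVERABLE asked for by the desk (res-L1-w45b-plan-1 RULING R16 (iii), 2026-08-28T06:26:26Z) for the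
card `tower-hilbert-closure` round 2: «FIRST crux-sized statement (R1)/(R3) — the downstairs INCIDENCE VARIETY of the tower's prefix data
has expected dimension ⇒ the prefix (hence the rigid hosted round) lifts», and the typed toy (R2) (Fano, `decide`-level linear algebra over 𝔽₂),
as SORRIED statements that elaborate. Nothing is registered here (R10: only the text owner runs `ledger skeleton check`); nothing of
[Hironaka2017] is asserted or used; AI-written, weaker than expert review; NOT a statement of the manuscript.

THE DICTIONARY (isolated game, after exit-rounds r2 (M) and RESIDUE1-CENSUS (W1)/(j1)): a rigid hosted round (section `σ = M̃ ∩ E_{C_Z}`,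
`σ² = a ≤ −2` in `E_{C_Z}`) is liftable iff the PREFIX was lifted coherently — the lifted points `q̃ᵢ ∈ Ẽ_p(O) ≅ ℙ²(O)`, the lifted member
planes / lines `M̃`, `Z̃ = Ẽ_p ∩ W̃`, … satisfy upstairs every incidence `q̃ᵢ ∈ Z̃`, `q̃ᵢ ∈ M̃`, `Z̃ ⊆ M̃` that a LATER centre of the k-tower is defined by.
The prefix data of the `E_p`-game is a finite INCIDENCE STRUCTURE of points and lines in `E_p ≅ ℙ²_k` (member planes through `p` ARE lines of `E_p`;
curves `E_p ∩ W̃` are lines; collinearities/concurrencies are the incidences), so the deciding object is the REALISATION SCHEME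
`ℛ_I ⊆ (𝔸³)^P × (𝔸³)^L` over `O`, cut by the `|I|` bilinear equations `⟨q̃ᵢ, m̃ⱼ⟩ = 0`, at the k-point `t = (q, m)` given by the k-tower:
* (S5) EXPECTED DIMENSION ⇒ RAMIFIED REALISATION: `dim_t (ℛ_I)_k ≤ 3|P| + 3|L| − |I|` ⇒ a realisation over a finite extension `O ⊆ O′` of complete
  DVRs specialising to `t` (Krull height bound ⇒ a component through `t` not killed by `ϖ` ⇒ `O`-flat ⇒ (S1) of `Sketch_L1_idea_2_g12.lean`).
  This is (R1) = the `E_p`-game instance of (T2)/(S1) of the card; (R3) is the CLAIM, per census family, that the hypothesis holds (specimen table in the card).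
* (S6) LINEARISED (T² = 0) ⇒ UNRAMIFIED REALISATION over `O = W(k)` itself: the differential `δ` of the incidence map at `t` is ONTO
  (`coker δ = T²(configuration) = 0`) ⇒ multivariate Hensel. `coker δ` is the obstruction space of the simultaneous embedded deformation functor of the
  diagram {qᵢ ∈ mⱼ}; it is the planar shadow of the tower's `T² = Σⱼ coker(T¹ⱼ → H¹(N^{es}_{Cⱼ}))` (card §T-CALCULUS), and (S6) is the degenerate case
  «rank δ maximal» of the sister card's (J3).
* (T7) TYPED TOY (R2): the Fano plane PG(2,2) over `𝔽₂` — 7 points, 7 lines, 21 incidences, `3·7 + 3·7 − 21 = 21` expected, but the SUM OF ALL 21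
  INCIDENCE DIFFERENTIALS VANISHES identically at the 𝔽₂-realisation (every point lies on 3 lines whose covectors sum to 0, dually), a non-zero element
  of `(coker δ)^∨`: `rank δ ≤ 20 < 21`, `T² ≠ 0`, the special fibre of `ℛ_I` is smooth of dimension `42 − 20 = 22 > 21` (= `GL₃ × 𝔾_m^{14}/𝔾_m`-orbit),
  so (S5) and (S6) are both SILENT — consistent with the landed `EquisingularLift/Negative/FanoConfigurationNoLift` (p492869): no lift over any `O′`.
* (S4) THE ENGINE BRICK the dictionary needs for CURVES (points are idea-1's `stub_nested_section` / lead-1's NestedSectionInModels): «EmbeddedCurveLiftAt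
  THROUGH PRESCRIBED SECTIONS» — a regular curve `Z ⊆ Ẽ` on the special fibre of the proper flat regular host model `V(𝓔)` lifts to an `O`-flat regular
  `C ⊆ V(𝓔)` CONTAINING given `O`-sections `V(𝓢ᵢ) ⊆ V(𝓔)` through points `yᵢ ∈ Z`, provided the embedded deformations of the strict transform of `Z` in
  the blow-up of `Ẽ` at the `yᵢ` are unobstructed (`H¹(Z, 𝒩_{Z/Ẽ}(−Σ yᵢ)) = 0`; for `Z ≅ ℙ¹`: `Z·Z − c ≥ −1`). Proof route: blow `X` up along the
  disjoint sections (regular centre ⇒ regular), apply `EmbeddedCurveLiftAt` (T-k) on the new host `Bl_{y}V(𝓔)` to `St(Z)`, push down; the image contains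
  each `V(𝓢ᵢ)` because the lift meets each exceptional `ℙ¹_O` in a degree-one `O`-flat subscheme. It is the `h¹ = 0` half of the coherent-prefix
  problem in the chain's own currency (`EmbeddedCurveLiftAt`, `DirStepUnobs`, `redSub`, `IsBlowup`), typed so that stub-4's T23-B memo can name it.
-/

set_option linter.dupNamespace false
set_option linter.overlappingInstances false
set_option linter.unusedVariables false

noncomputable section

open CategoryTheory AlgebraicGeometry TopologicalSpace
open AlgebraicGeometry.Scheme.IdealSheafData
open Literature.AlgebraicGeometry.Resolution
open Summit.ResolutionOfSingularities.ResolutionOfSingularities.Cruxes.EquisingularLiftNat.Sections (redSub redSubι DirStepUnobs)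
open IsLocalRing

namespace Summit.ResolutionOfSingularities.ResolutionOfSingularities.Cruxes.EquisingularLiftNatThree.Idea2

/-! ## (S4) EmbeddedCurveLiftAt through prescribed sections (tree currency) -/

/-- (S4) **Embedded curve lift THROUGH PRESCRIBED SECTIONS.** Data as in `Sections.EmbeddedCurveLiftAt O k θ X σ q 𝓔` (stage `X → P → Spec O`,
host model `V(𝓔)` regular, flat and proper over `O`, model square `(G, j, t)` over the residue map `θ`, reduced trace `E` of `𝓔`, regular closed
curve `Z ⊆ E` along which `Ẽ` is regular), plus finitely many ideal sheaves `𝓢 i ≥ 𝓔` whose subschemes are SECTIONS of `X → Spec O`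
(`V(𝓢 i) ≅ Spec O`) with reduced traces the distinct closed points `y i ∈ Z`. HYPOTHESIS (twisted unobstructedness, blow-up form): for every blow-up
`β : B → Ẽ` of the reduced surface `Ẽ` along the reduced finite set `{y i}`, the closure of `β⁻¹(Z ∖ {y i})` (strict transform of `Z`) has unobstructed
embedded deformations in `B` (`DirStepUnobs`, i.e. `Ȟ¹(St Z, 𝒩_{St Z/B}) = H¹(Z, 𝒩_{Z/Ẽ}(−Σᵢ yᵢ)) = 0`). CONCLUSION: a centre `C` with `𝓔 ≤ C ≤ 𝓢 i`
for all `i` (inside the host, containing every section), regular, flat over `O`, with reduced trace `Z`.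
[OURS · sorried · believed TRUE via `EmbeddedCurveLiftAt` on `Bl_{⋃ V(𝓢 i)} X`; consumed by nobody yet; NOT a statement of the manuscript.] -/
theorem stub_embeddedCurveLift_through_sections
    (O : Type) [CommRing O] [IsDomain O] [IsDiscreteValuationRing O] [IsAdicComplete (maximalIdeal O) O]
    (k : Type) [Field k] [IsAlgClosed k] (θ : O →+* k) (hθ : Function.Surjective θ)
    {P : Scheme.{0}} (X : Scheme.{0}) (σ : X ⟶ P) (q : P ⟶ Spec (.of O)) (𝓔 : X.IdealSheafData)
    (hXi : IsIntegral X) (hXn : IsLocallyNoetherian X) (hXr : Scheme.IsRegular X)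
    (h𝓔r : Scheme.IsRegular 𝓔.subscheme) (h𝓔f : Flat (𝓔.subschemeι ≫ σ ≫ q)) (h𝓔p : IsProper (𝓔.subschemeι ≫ σ ≫ q))
    (G : Scheme.{0}) (j : G ⟶ X) (t : G ⟶ Spec (.of k))
    (hsq : IsPullback j t (σ ≫ q) (Spec.map (CommRingCat.ofHom θ)))
    (E : Set G) (hE : IsClosed E) (hEtr : 𝓔.comap j = vanishingIdeal (⟨E, hE⟩ : Closeds G))
    (Z : Set G) (hZ : IsClosed Z) (hZE : Z ⊆ E)
    (hZreg : ∀ x : redSub G Z hZ, IsRegularLocalRing ((redSub G Z hZ).presheaf.stalk x))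
    (hEreg : ∀ (i : redSub G Z hZ ⟶ redSub G E hE), i ≫ redSubι G E hE = redSubι G Z hZ →
      ∀ x : redSub G Z hZ, IsRegularLocalRing ((redSub G E hE).presheaf.stalk (i x)))
    (c : ℕ) (𝓢 : Fin c → X.IdealSheafData) (h𝓢E : ∀ i, 𝓔 ≤ 𝓢 i)
    (h𝓢sec : ∀ i, IsIso ((𝓢 i).subschemeι ≫ σ ≫ q))
    (y : Fin c → G) (hy : ∀ i, y i ∈ Z) (hyinj : Function.Injective y) (hyc : ∀ i, IsClosed ({y i} : Set G))
    (h𝓢tr : ∀ i, (𝓢 i).comap j = vanishingIdeal (⟨{y i}, hyc i⟩ : Closeds G))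
    (hYc : IsClosed ((redSubι G E hE) ⁻¹' Set.range y))
    (hUnobs : ∀ (B : Scheme.{0}) (β : B ⟶ redSub G E hE),
      IsBlowup β (vanishingIdeal (⟨(redSubι G E hE) ⁻¹' Set.range y, hYc⟩ : Closeds (redSub G E hE))) →
      DirStepUnobs B Set.univ isClosed_univ
        (closure (β ⁻¹' ((redSubι G E hE) ⁻¹' (Z \ Set.range y)))) isClosed_closure) :
    ∃ C : X.IdealSheafData, 𝓔 ≤ C ∧ (∀ i, C ≤ 𝓢 i) ∧ Scheme.IsRegular C.subscheme ∧
      Flat (C.subschemeι ≫ σ ≫ q) ∧ C.comap j = vanishingIdeal (⟨Z, hZ⟩ : Closeds G) := by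
  sorry

/-! ## (S5)/(S6) Planar incidence structures: realisation over `O′` from expected dimension, over `O` from `T² = 0` -/

/-- The `|I|` bilinear INCIDENCE EQUATIONS `⟨xᵢ, ξⱼ⟩ = Σₐ x_{i,a} ξ_{j,a}` of a finite incidence structure `I ⊆ P × L` (points `P`, lines `L`
of a projective plane, in cone coordinates), as polynomials in the `3|P| + 3|L|` coordinates over any commutative ring. -/
def incidencePoly (R : Type) [CommRing R] (P L : Type) (e : P × L) : MvPolynomial ((P × Fin 3) ⊕ (L × Fin 3)) R :=
  ∑ a : Fin 3, MvPolynomial.X (Sum.inl (e.1, a)) * MvPolynomial.X (Sum.inr (e.2, a))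

/-- (S5) **Expected dimension of the downstairs realisation space ⇒ realisation over a finite (possibly RAMIFIED) extension `O ⊆ O′`.**
`O` a complete DVR with residue map `θ` onto the algebraically closed `k`; a k-realisation `(q, m)` of the incidence structure `I`
(`⟨qᵢ, mⱼ⟩ = 0` for `(i,j) ∈ I`); HYPOTHESIS (EDL at `t = (q,m)`): the local ring at `t` of the k-realisation scheme
`Spec k[x, ξ]/(incidence equations)` has Krull dimension `≤ 3|P| + 3|L| − |I|`. CONCLUSION: a finite extension of DVRs `O ⊆ O′` with residue map
`θ′` onto `k` extending `θ`, and lifts `q̃ᵢ, m̃ⱼ` over `O′` reducing to `qᵢ, mⱼ` and satisfying every incidence of `I`. (Non-vanishing of the lifts is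
automatic from that of the reductions, so they ARE points/lines of `ℙ²(O′)`.) Proof route: Krull's height theorem in `O[x,ξ]_𝔪` (every component through
`t` has dimension `≥ 1 + 3|P| + 3|L| − |I|`) ⇒ some component through `t` is not contained in `{ϖ = 0}` ⇒ its coordinate ring is `O`-torsion-free, hence
flat of finite type ⇒ `stub_exists_dvrPoint_of_flat_finiteType` (S1, `Sketch_L1_idea_2_g12.lean`) ⇒ an `O′`-point through `𝔪_t`; `k = k̄` identifies the
residue field. [OURS · sorried · TRUE (standard); the (R1) half of `tower-hilbert-closure` for the `E_p`-game; NOT a statement of the manuscript.] -/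
theorem stub_planarIncidence_ramifiedRealisation_of_expectedDim
    (O : Type) [CommRing O] [IsDomain O] [IsDiscreteValuationRing O] [IsAdicComplete (maximalIdeal O) O]
    (k : Type) [Field k] [IsAlgClosed k] (θ : O →+* k) (hθ : Function.Surjective θ)
    (P L : Type) [Fintype P] [Fintype L] [DecidableEq P] [DecidableEq L] (I : Finset (P × L))
    (q : P → Fin 3 → k) (m : L → Fin 3 → k) (hq : ∀ i, q i ≠ 0) (hm : ∀ j, m j ≠ 0)
    (hinc : ∀ e ∈ I, ∑ a : Fin 3, q e.1 a * m e.2 a = 0)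
    (hEDL :
      ringKrullDim
          (Localization.AtPrime
              (RingHom.ker (MvPolynomial.aeval (R := k)
                (Sum.elim (fun ia : P × Fin 3 => q ia.1 ia.2) (fun ja : L × Fin 3 => m ja.1 ja.2))).toRingHom :
                Ideal (MvPolynomial ((P × Fin 3) ⊕ (L × Fin 3)) k)) ⧸
            (Ideal.span ((incidencePoly k P L) '' (I : Set (P × L)))).map
              (algebraMap (MvPolynomial ((P × Fin 3) ⊕ (L × Fin 3)) k)
                (Localization.AtPrime
                  (RingHom.ker (MvPolynomial.aeval (R := k)
                    (Sum.elim (fun ia : P × Fin 3 => q ia.1 ia.2) (fun ja : L × Fin 3 => m ja.1 ja.2))).toRingHom :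
                    Ideal (MvPolynomial ((P × Fin 3) ⊕ (L × Fin 3)) k)))))
        + (I.card : WithBot ℕ∞) ≤ ((3 * Fintype.card P + 3 * Fintype.card L : ℕ) : WithBot ℕ∞)) :
    ∃ (O' : Type) (_ : CommRing O') (_ : IsDomain O') (_ : IsDiscreteValuationRing O') (_ : Algebra O O')
      (_ : Module.Finite O O') (θ' : O' →+* k),
      Function.Surjective θ' ∧ θ'.comp (algebraMap O O') = θ ∧
      ∃ (q' : P → Fin 3 → O') (m' : L → Fin 3 → O'),
        (∀ i a, θ' (q' i a) = q i a) ∧ (∀ j a, θ' (m' j a) = m j a) ∧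
        ∀ e ∈ I, ∑ a : Fin 3, q' e.1 a * m' e.2 a = 0 := by
  sorry

/-- (S6) **`T² = 0` (the differential of the incidence map at `t` is onto) ⇒ UNRAMIFIED realisation over `O` itself.** Same data over a complete
DVR `O` (any residue field); HYPOTHESIS: the k-linear map `δ : k^{3|P|+3|L|} → k^{I}`, `δ(dq, dm)_{(i,j)} = ⟨dqᵢ, mⱼ⟩ + ⟨qᵢ, dmⱼ⟩` (the Jacobian of
the incidence equations at `t`) is SURJECTIVE — equivalently the obstruction space `coker δ` of the simultaneous embedded deformation functor of the
diagram `{qᵢ ∈ mⱼ}` vanishes. CONCLUSION: lifts over `O` with all incidences (multivariate Hensel: the realisation scheme is smooth over `O` at `t`).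
This is the `rank δ` maximal case of the sister card's (J3) and the `h¹ = 0` case of (R3); where it is silent, (S5) may still fire with ramification,
and where (S5) is silent too the configuration is superabundant ((T7): Fano). [OURS · sorried · TRUE (standard); NOT a statement of the manuscript.] -/
theorem stub_planarIncidence_realisation_of_surjective_differential
    (O : Type) [CommRing O] [IsDomain O] [IsDiscreteValuationRing O] [IsAdicComplete (maximalIdeal O) O]
    (k : Type) [Field k] (θ : O →+* k) (hθ : Function.Surjective θ)
    (P L : Type) [Fintype P] [Fintype L] [DecidableEq P] [DecidableEq L] (I : Finset (P × L))
    (q : P → Fin 3 → k) (m : L → Fin 3 → k)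
    (hinc : ∀ e ∈ I, ∑ a : Fin 3, q e.1 a * m e.2 a = 0)
    (hδ : Function.Surjective
      (fun (d : ((P × Fin 3) ⊕ (L × Fin 3)) → k) (e : ↥I) =>
        ∑ a : Fin 3, (d (Sum.inl ((e : P × L).1, a)) * m (e : P × L).2 a + q (e : P × L).1 a * d (Sum.inr ((e : P × L).2, a))))) :
    ∃ (q' : P → Fin 3 → O) (m' : L → Fin 3 → O),
      (∀ i a, θ (q' i a) = q i a) ∧ (∀ j a, θ (m' j a) = m j a) ∧
      ∀ e ∈ I, ∑ a : Fin 3, q' e.1 a * m' e.2 a = 0 := by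
  sorry

/-! ## (T7) Typed toy (R2): the Fano plane over `𝔽₂` is superabundant — a `decide`-level certificate that `coker δ ≠ 0` -/

/-- The seven non-zero vectors of `𝔽₂³`; they index BOTH the points and (as covectors) the lines of PG(2,2), incidence = orthogonality. -/
def fanoVec : Fin 7 → Fin 3 → ZMod 2 :=
  ![![1, 0, 0], ![0, 1, 0], ![0, 0, 1], ![1, 1, 0], ![1, 0, 1], ![0, 1, 1], ![1, 1, 1]]

/-- Incidence of PG(2,2) in cone coordinates over `𝔽₂`: point `i` lies on line `j` iff `⟨vᵢ, vⱼ⟩ = 0`. (Boolean, so that everything `decide`s.) -/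
def fanoInc (i j : Fin 7) : Bool :=
  decide (∑ a : Fin 3, fanoVec i a * fanoVec j a = 0)

/-- (T7-a) PG(2,2) has 21 incidences (each point on 3 lines), so the expected dimension of its cone realisation space is `3·7 + 3·7 − 21 = 21`. -/
theorem fano_incidence_card :
    (Finset.univ.filter (fun e : Fin 7 × Fin 7 => fanoInc e.1 e.2 = true)).card = 21 := by
  decide

/-- (T7-b) **Superabundance certificate.** At the `𝔽₂`-realisation the all-ones functional kills the image of the differential `δ` of (S6): for every
coordinate direction the sum over the incident pairs of the corresponding partial derivative vanishes — the three lines through a point have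
covectors summing to `0`, and dually. Hence the 21 incidence differentials are linearly DEPENDENT, `rank δ ≤ 20 < 21 = |I|`, `coker δ ≠ 0`
(`T² ≠ 0`): (S6) is silent; and since the `𝔽̄₂`-realisation space is the 22-dimensional `GL₃ × 𝔾_m¹⁴/𝔾_m`-orbit (`> 21` expected), (S5) is silent
too — consistent with `EquisingularLift/Negative/FanoConfigurationNoLift` (p492869). [decide-level; OURS.] -/
theorem fano_superabundance_certificate :
    (∀ i : Fin 7, ∀ a : Fin 3, (∑ j ∈ Finset.univ.filter (fun j : Fin 7 => fanoInc i j = true), fanoVec j a) = 0) ∧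
    (∀ j : Fin 7, ∀ a : Fin 3, (∑ i ∈ Finset.univ.filter (fun i : Fin 7 => fanoInc i j = true), fanoVec i a) = 0) := by
  decide

end Summit.ResolutionOfSingularities.ResolutionOfSingularities.Cruxes.EquisingularLiftNatThree.Idea2

end
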